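import Summits.QuantumFields.YangMills.Theorems.UnitScaleTiltProp8IterTransport
import Literature.MathematicalPhysics.QuantumFieldTheory.Balaban1983to89.T3RegularMinimiser
import HarnessLib

/-!
# Route `UnitScaleTilt`, crux K1 «MinimiserStabilityRegPr» (stmt-QuantumFields-19200), leaf V2′ `stub_halvingStep` — sub-lemma C_k / P0, FILE 2 of 2:
# **k-UNIFORM MULTI-LEVEL PLAQUETTE SMALLNESS OF THE (0.4)-DESCENT, GAUGE-FREE**

Cell `ym3-torus` ∕ fleet seat `ym-ust-19200-p2` g5.  WHY.  The k-fold Euler–Lagrange / chart theorems of this lineage (p516212, p519004, p526141,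
p526705) carry the explicit hypothesis «all iterated (0.4)-averages `Ū^{(i)}`, `i < k`, are `t₀`-small» (plaquette variables within `t₀` of `1`).
Print obtains the multi-level smallness of the averages of a configuration of the space (6)(ε₀) inside a cube from the axial gauge
([Balaban1985Variational] (145)–(146)); the one-step bound in the tree (`BlockAveragingPlaquetteBound.plaqSmall_blockAvg_expMeanLogSU`:
`PlaqSmall a U ⇒ PlaqSmall ((L² + 6((d+2)L)²)·a) Ū`) iterates to a factor `(L² + 6((d+2)L)²)^i` instead of `L^{2i}` and is useless over
`k = K − n` levels.  THIS FILE proves the k-UNIFORM statement: if every plaquette variable of the fine field `U` is within `a` of `1`, then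
every plaquette variable of the `i`-fold (0.4)-average `Ū^{(i)}` is within `4(B+1)·L^{2i}·a` of `1` with `B = B(d, L)` INDEPENDENT of `i`, `k` and
the volume (at the d = 3 carrier `a = ε₀L^{−2(K−n)}`, so `Ū^{(i)}` is `505·ε₀L^{−2(K−n−i)}`-small for `L ≥ 7` — print's scaling).

THE ARGUMENT (elementary, gauge-free; no gradient control, hence a block-size threshold).  (i) File 1's transport comparison:
`dist1(Ū^{(i)}(w)·U(refineⁱ w)⁻¹) ≤ |w|·τ_i` whenever the correction factors of the levels `< i` are within `κ_{i'}` and `τ` super-solves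
`τ_{i+1} ≥ κ_i + Lτ_i`.  (ii) LOOP BOUND: a (0.4) loop variable of `Ū^{(i)}` (closed word of length `≤ ℓ = (d+2)L`) is within `ℓτ_i + (ℓ²L^{2i}/4)·a`
of `1` — the refined loop word is a CLOSED fine word of length `≤ ℓL^i`, so the crude non-abelian Stokes bound `LatticeWordStokes.dist1_holAt_le`
applies to it DIRECTLY at the finest level (this is where k-uniformity comes from: the area of the refined loop is counted once, not through `i`
one-step bounds).  (iii) File 1 §2: `κ_i ≤ (21/20)(ℓτ_i + ℓ²L^{2i}a/4)` (the guard of the total averaging only helps).  (iv) `τ_i := B·L^{2i}·a`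
super-solves the recursion as soon as `(21/20)ℓB + (21/20)ℓ²/4 + LB ≤ BL²` (`superSolution_of_dominated`), solvable iff `L² − L − (21/20)(d+2)L > 0`,
i.e. `L ≥ 7` at `d = 3` (`B = 100` for all `L ≥ 7`, `dominated_T3`); strong induction on the level gives `dist1_corr_iter_le`.  (v) A plaquette of
`Ū^{(i)}` is a 4-letter closed word: `dist1 ≤ 4τ_i + 4L^{2i}a = 4(B+1)L^{2i}a` (`dist1_plaqHol_iter_le`, `plaqSmall_iter`).  §6: the d = 3 carrier
form `plaqSmall_iter_T3` and the consumers' shape **`plaqSmall_iter_T3_lt`**: `PlaqSmall (ε₀L^{−2(K−n)}) U`, `L ≥ 7`, `0 < ε₀`, `50(500L + 7L²)ε₀ ≤ 1`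
⇒ `∀ i < K − n, PlaqSmall (505ε₀/L²) (Ū^{(i)})`.
HONEST SCOPE.  `L ∈ {3, 5}` are NOT covered (there `L + ℓ ≥ L²`: the crude length count cannot see the cancellation of the detour fluxes, which
needs curvature-gradient control — print's (146) via the axial gauge, or [Balaban1985Averaging] Prop. 3); the constants are crude; only the
plaquette clause of (2) is propagated (the divergence clause is not touched).  Sorry-free, definition-free.  NOT a claim about the mass gap.

References: T. Bałaban, CMP **102** (1985) 277–309 [Balaban1985Variational] ((2) p.278, (145)–(146) p.301); CMP **98** (1985) 17–51
[Balaban1985Averaging] ((19)–(20) p.21, Prop. 1 (51) p.26); CMP **109** (1987) 249–301 [Balaban1987RG1] ((0.4), (0.11) p.253).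
-/

noncomputable section

open scoped BigOperators

namespace Summit.QuantumFields.YangMills.Theorems.IterPlaqSmall

open Literature.MathematicalPhysics.QuantumFieldTheory.Balaban1983to89
open T4Continuum T4ReflectionCone BlockAveraging ExpMeanLog LatticeWordStokes BlockAveragingPlaquetteBound

/-! ## §5 The recursion and the k-uniform bounds -/

section Main

open scoped Matrix.Norms.L2Operator

variable {G : Type*} [GaugeGroup G]

variable {P : Params} {j : ℕ}

/-- A plaquette variable is the holonomy of the plaquette word `e_μ e_ν e_μ⁻¹ e_ν⁻¹`. [cite: Balaban1985Averaging, (9) p.19] -/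
theorem plaqHol_eq_holAt_walk (V : GaugeField P j G) (p : Plaq P j) :
    GaugeField.plaqHol V p = holAt V (walk p.src (plaqWord p.μ p.ν)) := by
  rw [walk_plaqWord]
  simp only [holAt, GaugeField.plaqHol, List.map_cons, List.map_nil, List.prod_cons, List.prod_nil, ↓reduceIte,
    Bool.false_eq_true, mul_one, mul_assoc]

/-- **`τ_i := B·L^{2i}·a` IS A SUPER-SOLUTION** of `τ_{i+1} ≥ κ_i + Lτ_i` with `κ_i := (21/20)(ℓB + ℓ²/4)L^{2i}a`, once
`(21/20)ℓB + (21/20)ℓ²/4 + LB ≤ BL²` (pure arithmetic). [cite: Balaban1985Variational, (146) p.301] -/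
theorem superSolution_of_dominated {L ℓ B a : ℝ} (hL : 0 ≤ L) (ha : 0 ≤ a)
    (hB : 21 / 20 * ℓ * B + 21 / 20 * (ℓ ^ 2 / 4) + L * B ≤ B * L ^ 2) (i : ℕ) :
    21 / 20 * ((ℓ * B + ℓ ^ 2 / 4) * L ^ (2 * i) * a) + L * (B * L ^ (2 * i) * a) ≤ B * L ^ (2 * (i + 1)) * a := by
  have hpow : 0 ≤ L ^ (2 * i) * a := mul_nonneg (pow_nonneg hL _) ha
  calc 21 / 20 * ((ℓ * B + ℓ ^ 2 / 4) * L ^ (2 * i) * a) + L * (B * L ^ (2 * i) * a)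
      = (21 / 20 * ℓ * B + 21 / 20 * (ℓ ^ 2 / 4) + L * B) * (L ^ (2 * i) * a) := by ring
    _ ≤ (B * L ^ 2) * (L ^ (2 * i) * a) := mul_le_mul_of_nonneg_right hB hpow
    _ = B * L ^ (2 * (i + 1)) * a := by ring

variable {n : Type*} [Fintype n] [DecidableEq n] [Nonempty n]

/-- **THE CORRECTION FACTORS AT EVERY LEVEL** (`ℓ = (d+2)L`): under `PlaqSmall a U` (`a ≥ 0`), the domination condition on `B ≥ 0`, the smallness
`(ℓB + ℓ²/4)·L^{2k}·a ≤ 1/50` and `1/50 < δ_N`: for every `i < k` every correction factor of the `(i+1)`-st (0.4)-average is within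
`(21/20)(ℓB + ℓ²/4)L^{2i}a` of `1` (strong induction: §4's transport comparison at level `i` + the crude Stokes bound for the REFINED loop words
at level `0` + §2). [cite: Balaban1985Variational, (145)-(146) p.301; Balaban1987RG1, (0.4) p.253] -/
theorem dist1_corr_iter_le (U : GaugeField P 0 (Matrix.specialUnitaryGroup n ℂ)) {a : ℝ} (ha : 0 ≤ a) (hU : PlaqSmall a U) (k : ℕ)
    {B : ℝ} (hB0 : 0 ≤ B)
    (hB : 21 / 20 * ((((P.d + 2) * P.L : ℕ) : ℝ)) * B + 21 / 20 * (((((P.d + 2) * P.L : ℕ) : ℝ)) ^ 2 / 4) + (P.L : ℝ) * B ≤ B * (P.L : ℝ) ^ 2)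
    (hsmall : (((((P.d + 2) * P.L : ℕ) : ℝ)) * B + ((((P.d + 2) * P.L : ℕ) : ℝ)) ^ 2 / 4) * (P.L : ℝ) ^ (2 * k) * a ≤ 1 / 50)
    (hδ : (1 : ℝ) / 50 < deltaSU n) :
    ∀ i, i < k → ∀ c : PBond P (i + 1),
      dist1 (corr (expMeanLogSU (n := n)) (Averaging.iter (fun j => blockAvg (P := P) (j := j) (expMeanLogSU (n := n))) i U) c) ≤
        21 / 20 * ((((((P.d + 2) * P.L : ℕ) : ℝ)) * B + ((((P.d + 2) * P.L : ℕ) : ℝ)) ^ 2 / 4) * (P.L : ℝ) ^ (2 * i) * a) := by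
  set ℓ : ℝ := (((P.d + 2) * P.L : ℕ) : ℝ) with hℓ_def
  have hℓ0 : 0 ≤ ℓ := Nat.cast_nonneg _
  have hL1 : (1 : ℝ) ≤ (P.L : ℝ) := by exact_mod_cast P.L_pos
  have hL0 : (0 : ℝ) ≤ (P.L : ℝ) := zero_le_one.trans hL1
  have hκ0 : ∀ i, 0 ≤ 21 / 20 * ((ℓ * B + ℓ ^ 2 / 4) * (P.L : ℝ) ^ (2 * i) * a) := fun i => by positivity
  have hτ0 : 0 ≤ B * (P.L : ℝ) ^ (2 * 0) * a := by positivity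
  have hτ : ∀ i, 21 / 20 * ((ℓ * B + ℓ ^ 2 / 4) * (P.L : ℝ) ^ (2 * i) * a) + (P.L : ℝ) * (B * (P.L : ℝ) ^ (2 * i) * a) ≤
      B * (P.L : ℝ) ^ (2 * (i + 1)) * a := superSolution_of_dominated hL0 ha hB
  intro i
  induction i using Nat.strong_induction_on with
  | _ i ih =>
    intro hik c
    have hκ : ∀ i', i' < i → ∀ c : PBond P (i' + 1),
        dist1 (corr (expMeanLogSU (n := n)) (Averaging.iter (fun j => blockAvg (P := P) (j := j) (expMeanLogSU (n := n))) i' U) c) ≤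
          21 / 20 * ((ℓ * B + ℓ ^ 2 / 4) * (P.L : ℝ) ^ (2 * i') * a) :=
      fun i' hi' c => ih i' hi' (hi'.trans hik) c
    have htrans := dist1_holAt_iter_mul_inv_le (expMeanLogSU (n := n)) U i hκ0 hτ0 hτ hκ i le_rfl
    -- `L^{2i} ≤ L^{2k}`
    have hmono : (P.L : ℝ) ^ (2 * i) ≤ (P.L : ℝ) ^ (2 * k) := pow_le_pow_right₀ hL1 (by omega)
    have ht : (ℓ * B + ℓ ^ 2 / 4) * (P.L : ℝ) ^ (2 * i) * a ≤ 1 / 50 := by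
      refine le_trans ?_ hsmall
      have hc : 0 ≤ ℓ * B + ℓ ^ 2 / 4 := by positivity
      exact mul_le_mul_of_nonneg_right (mul_le_mul_of_nonneg_left hmono hc) ha
    -- the loop variables of `Ū^{(i)}` at `c`
    have hloop : ∀ idx : Idx P,
        dist1 (loopHol (Averaging.iter (fun j => blockAvg (P := P) (j := j) (expMeanLogSU (n := n))) i U) c idx) ≤
          (ℓ * B + ℓ ^ 2 / 4) * (P.L : ℝ) ^ (2 * i) * a := by
      intro idx
      set lw := loopWord P.L c.dir (off idx.1) idx.2.1 idx.2.2 with hlw_def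
      obtain ⟨x, h1⟩ := htrans lw (emb c.src)
      set fw := (fun w : List (Letter P.d) => w.flatMap (fun l => List.replicate P.L l))^[i] lw with hfw_def
      have hclosed : ∀ ν, netDisp fw ν = 0 := fun ν => by
        rw [hfw_def, netDisp_iterate_flatMap_replicate, netDisp_loopWord, mul_zero]
      have h2 := dist1_holAt_le U ha hU fw hclosed x
      have hlw : (lw.length : ℝ) ≤ ℓ := by rw [hℓ_def]; exact_mod_cast length_loopWord_le c idx
      have hlen : (fw.length : ℝ) ≤ (P.L : ℝ) ^ i * ℓ := by
        rw [hfw_def, length_iterate_flatMap_replicate, Nat.cast_mul, Nat.cast_pow]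
        exact mul_le_mul_of_nonneg_left hlw (pow_nonneg hL0 _)
      have hlen0 : (0 : ℝ) ≤ (fw.length : ℝ) := Nat.cast_nonneg _
      have hsq : (fw.length : ℝ) ^ 2 ≤ ((P.L : ℝ) ^ i * ℓ) ^ 2 := pow_le_pow_left₀ hlen0 hlen 2
      have hτi : 0 ≤ B * (P.L : ℝ) ^ (2 * i) * a := by positivity
      calc dist1 (loopHol (Averaging.iter (fun j => blockAvg (P := P) (j := j) (expMeanLogSU (n := n))) i U) c idx)
          ≤ dist1 (holAt (Averaging.iter (fun j => blockAvg (P := P) (j := j) (expMeanLogSU (n := n))) i U) (walk (emb c.src) lw) *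
                (holAt U (walk x fw))⁻¹) + dist1 (holAt U (walk x fw)) :=
            (le_of_eq_of_le (congrArg dist1 (inv_mul_cancel_right _ (holAt U (walk x fw))).symm) (GaugeGroup.dist1_mul_le _ _))
        _ ≤ (lw.length : ℝ) * (B * (P.L : ℝ) ^ (2 * i) * a) + ((fw.length : ℝ) ^ 2 / 4) * a := add_le_add h1 h2
        _ ≤ ℓ * (B * (P.L : ℝ) ^ (2 * i) * a) + (((P.L : ℝ) ^ i * ℓ) ^ 2 / 4) * a := by
            refine add_le_add (mul_le_mul_of_nonneg_right hlw hτi) (mul_le_mul_of_nonneg_right ?_ ha)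
            linarith
        _ = (ℓ * B + ℓ ^ 2 / 4) * (P.L : ℝ) ^ (2 * i) * a := by ring
    exact dist1_corr_le_of_loopHol _ c hloop ht (lt_of_le_of_lt ht hδ)

/-- **k-UNIFORM MULTI-LEVEL PLAQUETTE SMALLNESS** (`ℓ = (d+2)L`): under the hypotheses of `dist1_corr_iter_le`, for every `i ≤ k` every plaquette
variable of the `i`-fold (0.4)-average `Ū^{(i)}` is within `4(B+1)·L^{2i}·a` of `1` — the constant does not depend on `i`, `k` or the volume.
[cite: Balaban1985Variational, (146) p.301; Balaban1985Averaging, Prop. 1 (51) p.26] -/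
theorem dist1_plaqHol_iter_le (U : GaugeField P 0 (Matrix.specialUnitaryGroup n ℂ)) {a : ℝ} (ha : 0 ≤ a) (hU : PlaqSmall a U) (k : ℕ)
    {B : ℝ} (hB0 : 0 ≤ B)
    (hB : 21 / 20 * ((((P.d + 2) * P.L : ℕ) : ℝ)) * B + 21 / 20 * (((((P.d + 2) * P.L : ℕ) : ℝ)) ^ 2 / 4) + (P.L : ℝ) * B ≤ B * (P.L : ℝ) ^ 2)
    (hsmall : (((((P.d + 2) * P.L : ℕ) : ℝ)) * B + ((((P.d + 2) * P.L : ℕ) : ℝ)) ^ 2 / 4) * (P.L : ℝ) ^ (2 * k) * a ≤ 1 / 50)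
    (hδ : (1 : ℝ) / 50 < deltaSU n) :
    ∀ i, i ≤ k → ∀ p : Plaq P i,
      dist1 (GaugeField.plaqHol (Averaging.iter (fun j => blockAvg (P := P) (j := j) (expMeanLogSU (n := n))) i U) p) ≤
        4 * (B + 1) * (P.L : ℝ) ^ (2 * i) * a := by
  set ℓ : ℝ := (((P.d + 2) * P.L : ℕ) : ℝ) with hℓ_def
  have hℓ0 : 0 ≤ ℓ := Nat.cast_nonneg _
  have hL1 : (1 : ℝ) ≤ (P.L : ℝ) := by exact_mod_cast P.L_pos
  have hL0 : (0 : ℝ) ≤ (P.L : ℝ) := zero_le_one.trans hL1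
  have hκ0 : ∀ i, 0 ≤ 21 / 20 * ((ℓ * B + ℓ ^ 2 / 4) * (P.L : ℝ) ^ (2 * i) * a) := fun i => by positivity
  have hτ0 : 0 ≤ B * (P.L : ℝ) ^ (2 * 0) * a := by positivity
  have hτ : ∀ i, 21 / 20 * ((ℓ * B + ℓ ^ 2 / 4) * (P.L : ℝ) ^ (2 * i) * a) + (P.L : ℝ) * (B * (P.L : ℝ) ^ (2 * i) * a) ≤
      B * (P.L : ℝ) ^ (2 * (i + 1)) * a := superSolution_of_dominated hL0 ha hB
  intro i hik p
  have hκ := dist1_corr_iter_le U ha hU k hB0 hB hsmall hδ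
  obtain ⟨x, htrans⟩ := dist1_holAt_iter_mul_inv_le (expMeanLogSU (n := n)) U k hκ0 hτ0 hτ hκ i hik (plaqWord p.μ p.ν) p.src
  set fw := (fun w : List (Letter P.d) => w.flatMap (fun l => List.replicate P.L l))^[i] (plaqWord p.μ p.ν) with hfw_def
  have hclosed : ∀ ν, netDisp fw ν = 0 := fun ν => by
    rw [hfw_def, netDisp_iterate_flatMap_replicate, netDisp_plaqWord, mul_zero]
  have h2 := dist1_holAt_le U ha hU fw hclosed x
  have hlen : (fw.length : ℝ) = 4 * (P.L : ℝ) ^ i := by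
    rw [hfw_def, length_iterate_flatMap_replicate, Nat.cast_mul, Nat.cast_pow]
    simp [plaqWord]
    ring
  rw [hlen] at h2
  rw [plaqHol_eq_holAt_walk]
  have hplen : ((plaqWord p.μ p.ν).length : ℝ) = 4 := by simp [plaqWord]
  rw [hplen] at htrans
  calc dist1 (holAt (Averaging.iter (fun j => blockAvg (P := P) (j := j) (expMeanLogSU (n := n))) i U) (walk p.src (plaqWord p.μ p.ν)))
      ≤ dist1 (holAt (Averaging.iter (fun j => blockAvg (P := P) (j := j) (expMeanLogSU (n := n))) i U) (walk p.src (plaqWord p.μ p.ν)) *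
            (holAt U (walk x fw))⁻¹) + dist1 (holAt U (walk x fw)) :=
            (le_of_eq_of_le (congrArg dist1 (inv_mul_cancel_right _ (holAt U (walk x fw))).symm) (GaugeGroup.dist1_mul_le _ _))
    _ ≤ 4 * (B * (P.L : ℝ) ^ (2 * i) * a) + ((4 * (P.L : ℝ) ^ i) ^ 2 / 4) * a := add_le_add htrans h2
    _ = 4 * (B + 1) * (P.L : ℝ) ^ (2 * i) * a := by ring

/-- The same as the tree's strict `PlaqSmall` predicate (`a > 0`): `Ū^{(i)}` is `5(B+1)L^{2i}a`-small for every `i ≤ k`.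
[cite: Balaban1985Variational, (146) p.301] -/
theorem plaqSmall_iter (U : GaugeField P 0 (Matrix.specialUnitaryGroup n ℂ)) {a : ℝ} (ha : 0 < a) (hU : PlaqSmall a U) (k : ℕ)
    {B : ℝ} (hB0 : 0 ≤ B)
    (hB : 21 / 20 * ((((P.d + 2) * P.L : ℕ) : ℝ)) * B + 21 / 20 * (((((P.d + 2) * P.L : ℕ) : ℝ)) ^ 2 / 4) + (P.L : ℝ) * B ≤ B * (P.L : ℝ) ^ 2)
    (hsmall : (((((P.d + 2) * P.L : ℕ) : ℝ)) * B + ((((P.d + 2) * P.L : ℕ) : ℝ)) ^ 2 / 4) * (P.L : ℝ) ^ (2 * k) * a ≤ 1 / 50)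
    (hδ : (1 : ℝ) / 50 < deltaSU n) :
    ∀ i, i ≤ k → PlaqSmall (5 * (B + 1) * (P.L : ℝ) ^ (2 * i) * a)
      (Averaging.iter (fun j => blockAvg (P := P) (j := j) (expMeanLogSU (n := n))) i U) := by
  intro i hik p
  have hL1 : (1 : ℝ) ≤ (P.L : ℝ) := by exact_mod_cast P.L_pos
  refine (dist1_plaqHol_iter_le U ha.le hU k hB0 hB hsmall hδ i hik p).trans_lt ?_
  have hpos : 0 < (B + 1) * (P.L : ℝ) ^ (2 * i) * a := by positivity
  nlinarith

end Main

/-! ## §6 At the d = 3 carrier: the iterated averages of a configuration of (6)(ε₀) are `505ε₀L^{−2(K−n−i)}`-small, `L ≥ 7` -/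

section T3

open scoped Matrix.Norms.L2Operator
open T3ContinuumYM3Torus T3RegularMinimiser

/-- `δ_{SU(2)} = min(1/3, π/2) > 1/50`. [folklore] -/
theorem one_div_fifty_lt_deltaSU_fin_two : (1 : ℝ) / 50 < deltaSU (Fin 2) := by
  unfold deltaSU
  rw [Fintype.card_fin]
  refine lt_min (by norm_num) ?_
  have := Real.pi_gt_three
  push_cast
  linarith

/-- The domination condition at `d = 3` (`ℓ = 5L`) with `B = 100` holds for every `L ≥ 7`:
`(21/20)·5L·100 + (21/20)·25L²/4 + 100L ≤ 100L²`. [folklore] -/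
theorem dominated_T3 (F : T3Family) (K : ℕ) (hL : 7 ≤ F.L) :
    21 / 20 * (((((F.P K).d + 2) * (F.P K).L : ℕ) : ℝ)) * 100 + 21 / 20 * ((((((F.P K).d + 2) * (F.P K).L : ℕ) : ℝ)) ^ 2 / 4) +
      ((F.P K).L : ℝ) * 100 ≤ 100 * ((F.P K).L : ℝ) ^ 2 := by
  have hd : (F.P K).d = 3 := T3Family.P_d F K
  have hLL : (F.P K).L = F.L := rfl
  rw [hd, hLL]
  have h7 : (7 : ℝ) ≤ (F.L : ℝ) := by exact_mod_cast hL
  push_cast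
  nlinarith

/-- **AT THE d = 3 CARRIER** (run `K`, comparison height `n`, `k = K − n`, block size `L ≥ 7`): if every plaquette variable of `U` is within
`ε₀L^{−2(K−n)}` of `1` (the plaquette clause of [Balaban1985Variational] (2)/(6), tree `regThreshold`), `0 < ε₀` and `50·(500L + 7L²)·ε₀ ≤ 1`, then
for every `i ≤ K − n` the `i`-fold (0.4)-average is `505·ε₀·L^{2i}·L^{−2(K−n)}`-small. [cite: Balaban1985Variational, (2) p.278 and (146) p.301] -/
theorem plaqSmall_iter_T3 (F : T3Family) (n K : ℕ) (hL : 7 ≤ F.L) {ε₀ : ℝ} (hε₀ : 0 < ε₀)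
    (hε : 50 * (500 * (F.L : ℝ) + 7 * (F.L : ℝ) ^ 2) * ε₀ ≤ 1)
    (U : GaugeField (F.P K) 0 (Matrix.specialUnitaryGroup (Fin 2) ℂ)) (hU : PlaqSmall (regThreshold F n K ε₀) U) :
    ∀ i, i ≤ K - n → PlaqSmall (505 * ((F.L : ℝ) ^ (2 * i) * regThreshold F n K ε₀))
      (Averaging.iter (fun j => blockAvg (P := F.P K) (j := j) (expMeanLogSU (n := Fin 2))) i U) := by
  intro i hik
  have hd : (F.P K).d = 3 := T3Family.P_d F K
  have hLL : ((F.P K).L : ℝ) = F.L := rfl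
  have hL0 : (0 : ℝ) < F.L := by exact_mod_cast (show 0 < F.L by omega)
  have hreg0 : 0 < regThreshold F n K ε₀ := by unfold regThreshold; positivity
  have hB := dominated_T3 F K hL
  -- smallness: `(500L + 6.25L²)·L^{2k}·ε₀L^{−2k} ≤ 1/50`
  have hpow : ((F.P K).L : ℝ) ^ (2 * (K - n)) * regThreshold F n K ε₀ = ε₀ := by
    rw [hLL, regThreshold, inv_pow, mul_comm, mul_assoc, inv_mul_cancel₀ (pow_ne_zero _ hL0.ne'), mul_one]
  have hsmall : ((((((F.P K).d + 2) * (F.P K).L : ℕ) : ℝ)) * 100 + (((((F.P K).d + 2) * (F.P K).L : ℕ) : ℝ)) ^ 2 / 4) *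
      ((F.P K).L : ℝ) ^ (2 * (K - n)) * regThreshold F n K ε₀ ≤ 1 / 50 := by
    rw [mul_assoc, hpow, hd]
    push_cast
    rw [hLL]
    nlinarith
  have h := plaqSmall_iter U hreg0 hU (K - n) (by norm_num) hB hsmall one_div_fifty_lt_deltaSU_fin_two i hik
  rw [hLL] at h
  intro p
  refine (h p).trans_le (le_of_eq ?_)
  ring

/-- `PlaqSmall` is monotone in the threshold. [folklore] -/
theorem plaqSmall_mono {P : Params} {j : ℕ} {G : Type*} [GaugeGroup G] {s t : ℝ} (hst : s ≤ t) {V : GaugeField P j G}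
    (h : PlaqSmall s V) : PlaqSmall t V := fun p => (h p).trans_le hst

/-- **THE HYPOTHESIS «ITERATED AVERAGES `t₀`-SMALL» OF THE k-FOLD EULER–LAGRANGE / CHART THEOREMS, DISCHARGED FOR (6)(ε₀)** (`L ≥ 7`): under the
hypotheses of `plaqSmall_iter_T3`, for every `i < K − n` the `i`-fold (0.4)-average of `U` is `t₀`-small with `t₀ = 505·ε₀/L²` — the shape
`∀ i, i < K − n → PlaqSmall t₀ (Averaging.iter … i U)` consumed by p516212/p519004/p526141/p526705. [cite: Balaban1985Variational, (146) p.301 and Prop. 8 p.304] -/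
theorem plaqSmall_iter_T3_lt (F : T3Family) (n K : ℕ) (hL : 7 ≤ F.L) {ε₀ : ℝ} (hε₀ : 0 < ε₀)
    (hε : 50 * (500 * (F.L : ℝ) + 7 * (F.L : ℝ) ^ 2) * ε₀ ≤ 1)
    (U : GaugeField (F.P K) 0 (Matrix.specialUnitaryGroup (Fin 2) ℂ)) (hU : PlaqSmall (regThreshold F n K ε₀) U) :
    ∀ i, i < K - n → PlaqSmall (505 * ε₀ / (F.L : ℝ) ^ 2)
      (Averaging.iter (fun j => blockAvg (P := F.P K) (j := j) (expMeanLogSU (n := Fin 2))) i U) := by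
  intro i hik
  have hL1 : (1 : ℝ) ≤ F.L := by exact_mod_cast (show 1 ≤ F.L by omega)
  have hL0 : (0 : ℝ) < F.L := by linarith
  refine plaqSmall_mono ?_ (plaqSmall_iter_T3 F n K hL hε₀ hε U hU i hik.le)
  -- `L^{2i}·ε₀L^{−2(K−n)} = ε₀·L^{−2(K−n−i)} ≤ ε₀/L²`
  unfold regThreshold
  have hsplit : ((F.L : ℝ)⁻¹) ^ (2 * (K - n)) = ((F.L : ℝ)⁻¹) ^ (2 * i) * (((F.L : ℝ)⁻¹) ^ 2 * ((F.L : ℝ)⁻¹) ^ (2 * (K - n - i - 1))) := by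
    rw [← pow_add, ← pow_add]; congr 1; omega
  rw [hsplit]
  have hcancel : (F.L : ℝ) ^ (2 * i) * ((F.L : ℝ)⁻¹) ^ (2 * i) = 1 := by
    rw [← mul_pow, mul_inv_cancel₀ hL0.ne', one_pow]
  have hle1 : ((F.L : ℝ)⁻¹) ^ (2 * (K - n - i - 1)) ≤ 1 := pow_le_one₀ (inv_nonneg.mpr hL0.le) (inv_le_one_of_one_le₀ hL1)
  calc 505 * ((F.L : ℝ) ^ (2 * i) * (ε₀ * (((F.L : ℝ)⁻¹) ^ (2 * i) * (((F.L : ℝ)⁻¹) ^ 2 * ((F.L : ℝ)⁻¹) ^ (2 * (K - n - i - 1))))))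
      = 505 * ε₀ * ((F.L : ℝ)⁻¹) ^ 2 * (((F.L : ℝ) ^ (2 * i) * ((F.L : ℝ)⁻¹) ^ (2 * i)) * ((F.L : ℝ)⁻¹) ^ (2 * (K - n - i - 1))) := by ring
    _ ≤ 505 * ε₀ * ((F.L : ℝ)⁻¹) ^ 2 * 1 := by
        rw [hcancel, one_mul]
        exact mul_le_mul_of_nonneg_left hle1 (by positivity)
    _ = 505 * ε₀ / (F.L : ℝ) ^ 2 := by rw [mul_one, inv_pow, div_eq_mul_inv]

end T3

end Summit.QuantumFields.YangMills.Theorems.IterPlaqSmall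

end
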